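import Mathlib.Probability.CDF
import Mathlib.MeasureTheory.Integral.Prod
import Mathlib.MeasureTheory.Integral.Bochner.Set
import Mathlib.Tactic
import HarnessLib

/-!
# The increasing rearrangement and `∫₀¹ 2t g*(t) dt = ∫₀¹∫₀¹ max(g(s), g(t)) ds dt`

Calegari–Dimitrov–Tang, arXiv:2408.15403, §2.4 (p. 11): for a measurable `g : (0,1) → ℝ`, the
*increasing rearrangement* `g*` is "the unique nondecreasing measurable function that has the
same distribution function as `g`. We thus have
`∫₀¹ 2t · g*(t) dt = ∫₀¹ ∫₀¹ max(g(s), g(t)) ds dt`" (eq. (maxintegral)) — the *rearrangement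
integrals* appearing in the numerators of the holonomy bounds (Theorem 52, Corollary 55) — and
"the trivial inequality `∫₀¹ 2t g*(t) dt ≤ ∫₀¹ 2 max(g*(t),0) dt = 2∫₀¹ max(g(t),0) dt`".
(The display (incr) of CDT prints `g*(t) := inf_s {P(g > s) ≤ t}`, which is non-increasing in
`t`; the intended nondecreasing function — cf. their Basic Remark 8, `g* = g` for increasing `g` —
is the quantile function used here.)

We realise `g*` as Durrett's inverse distribution function `X(ω) = sup{y : F(y) < ω}`,
`F(y) = λ{g ≤ y}` [Durrett2019, Thm 1.2.2]: `X(ω) ≤ x ↔ ω ≤ F(x)` on `(0,1)`, so `X` is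
nondecreasing and has distribution function `F` (the quantile transform), hence the same law as
`g`. The identity then follows from `max(g*(u), g*(v)) = g*(max(u,v))`, Fubini, and the law of
`max(U,V)` (density `2t`): `∫∫ max(g s, g t) = ∫∫ max(g* u, g* v) = ∫_v (v g*(v) + ∫_{(v,1)} g*)
= 2 ∫ t g*(t) dt`.

* `unitIoo` — Lebesgue measure on `(0,1)`; `law g`; `distFun g` (`F`).
* `incrRearrangement g` — `g*`; `incrRearrangement_le_iff` (Durrett's `(⋆)`),
  `monotoneOn_incrRearrangement`, `measureReal_incrRearrangement_le`,
  `law_incrRearrangement` (**equimeasurability**), `integral_comp_incrRearrangement`,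
  `integrable_incrRearrangement`.
* `integral_two_mul_incrRearrangement` — **the rearrangement identity**.
* `integral_two_mul_incrRearrangement_le` — the trivial bound `≤ 2 ∫ max(g, 0)`.

No named facts.

## References

* [CalegariDimitrovTang2024] arXiv:2408.15403, §2.4 eq. (incr), (maxintegral), Basic Remark 8
  (p. 11).
* [Durrett2019] R. Durrett, Probability: Theory and Examples (5th ed.), Thm 1.2.2 (p. 10).
-/

noncomputable section

open MeasureTheory Set Filter Topology ProbabilityTheory

namespace Literature.MeasureTheory.Integral

/-- Lebesgue measure on the unit interval `(0,1)`. [folklore] -/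
def unitIoo : Measure ℝ := volume.restrict (Ioo (0 : ℝ) 1)

/-- `unitIoo` is a probability measure. [folklore] -/
instance isProbabilityMeasure_unitIoo : IsProbabilityMeasure unitIoo :=
  ⟨by simp [unitIoo]⟩

/-- Unfolding `unitIoo`. [folklore] -/
theorem unitIoo_def : unitIoo = volume.restrict (Ioo (0 : ℝ) 1) := rfl

/-- Almost every point of `unitIoo` lies in `(0,1)`. [folklore] -/
theorem ae_mem_unitIoo : ∀ᵐ v ∂unitIoo, v ∈ Ioo (0 : ℝ) 1 := by
  rw [unitIoo_def]; exact ae_restrict_mem measurableSet_Ioo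

variable {g : ℝ → ℝ}

/-- The law of `g` under `unitIoo` (a probability measure on `ℝ`). [folklore] -/
def law (g : ℝ → ℝ) : Measure ℝ := unitIoo.map g

/-- The law of `g` is a probability measure. [folklore] -/
theorem isProbabilityMeasure_law (hg : AEMeasurable g unitIoo) : IsProbabilityMeasure (law g) :=
  MeasureTheory.Measure.isProbabilityMeasure_map hg

/-- The distribution function `F(y) = λ{x ∈ (0,1) : g(x) ≤ y}`. [folklore] -/
def distFun (g : ℝ → ℝ) (y : ℝ) : ℝ := unitIoo.real {x | g x ≤ y}

/-- `F` is the CDF of the law of `g`. [folklore] -/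
theorem distFun_eq_cdf (hg : AEMeasurable g unitIoo) (y : ℝ) : distFun g y = cdf (law g) y := by
  haveI := isProbabilityMeasure_law hg
  rw [cdf_eq_real, distFun, law, map_measureReal_apply_of_aemeasurable hg measurableSet_Iic]
  rfl

/-- `F` is nondecreasing. [folklore] -/
theorem distFun_mono (hg : AEMeasurable g unitIoo) : Monotone (distFun g) := by
  intro a b hab
  rw [distFun_eq_cdf hg, distFun_eq_cdf hg]
  exact (cdf (law g)).mono hab

/-- `0 ≤ F`. [folklore] -/
theorem distFun_nonneg (y : ℝ) : 0 ≤ distFun g y := measureReal_nonneg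

/-- `F ≤ 1`. [folklore] -/
theorem distFun_le_one (y : ℝ) : distFun g y ≤ 1 := by
  unfold distFun
  calc unitIoo.real {x | g x ≤ y} ≤ unitIoo.real univ := measureReal_mono (subset_univ _)
    _ = 1 := by simp

/-- **The increasing rearrangement** `g*` of `g : (0,1) → ℝ` (Durrett's inverse distribution
function `X(ω) = sup{y : F(y) < ω}`, [Durrett2019, Thm 1.2.2]): the nondecreasing function on
`(0,1)` with the same distribution as `g`. [cite: CalegariDimitrovTang2024, §2.4 eq. (incr) (p. 11)] -/
def incrRearrangement (g : ℝ → ℝ) (ω : ℝ) : ℝ := sSup {y : ℝ | distFun g y < ω}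

/-- `{y : F(y) < ω}` is nonempty for `ω > 0` (`F → 0` at `−∞`). [folklore] -/
theorem nonempty_ltSet (hg : AEMeasurable g unitIoo) {ω : ℝ} (hω : 0 < ω) :
    {y : ℝ | distFun g y < ω}.Nonempty := by
  haveI := isProbabilityMeasure_law hg
  have h := (tendsto_order.1 (tendsto_cdf_atBot (μ := law g))).2 ω hω
  obtain ⟨y, hy⟩ := h.exists
  exact ⟨y, by rw [mem_setOf_eq, distFun_eq_cdf hg]; exact hy⟩

/-- Some `F(z) > ω` for `ω < 1` (`F → 1` at `+∞`). [folklore] -/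
theorem exists_gt_distFun (hg : AEMeasurable g unitIoo) {ω : ℝ} (hω : ω < 1) :
    ∃ z, ω < distFun g z := by
  haveI := isProbabilityMeasure_law hg
  have h := (tendsto_order.1 (tendsto_cdf_atTop (μ := law g))).1 ω hω
  obtain ⟨z, hz⟩ := h.exists
  exact ⟨z, by rw [distFun_eq_cdf hg]; exact hz⟩

/-- `{y : F(y) < ω}` is bounded above for `ω < 1`. [folklore] -/
theorem bddAbove_ltSet (hg : AEMeasurable g unitIoo) {ω : ℝ} (hω : ω < 1) :
    BddAbove {y : ℝ | distFun g y < ω} := by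
  obtain ⟨z, hz⟩ := exists_gt_distFun hg hω
  refine ⟨z, fun y hy => ?_⟩
  rw [mem_setOf_eq] at hy
  by_contra hlt
  push Not at hlt
  have := distFun_mono hg hlt.le
  linarith

/-- **Durrett's (⋆)**: for `ω ∈ (0,1)`, `g*(ω) ≤ x ↔ ω ≤ F(x)`. [cite: Durrett2019, Thm 1.2.2 (p. 10)] -/
theorem incrRearrangement_le_iff (hg : AEMeasurable g unitIoo) {ω : ℝ} (hω : ω ∈ Ioo (0 : ℝ) 1)
    (x : ℝ) : incrRearrangement g ω ≤ x ↔ ω ≤ distFun g x := by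
  have hne := nonempty_ltSet hg hω.1
  have hbdd := bddAbove_ltSet hg hω.2
  constructor
  · intro h
    by_contra hlt
    push Not at hlt
    -- right-continuity: some `y > x` with `F y < ω`
    haveI := isProbabilityMeasure_law hg
    have hrc : ContinuousWithinAt (distFun g) (Ici x) x := by
      have := (cdf (law g)).right_continuous x
      rwa [show (distFun g) = cdf (law g) from funext (distFun_eq_cdf hg)]
    have hev : ∀ᶠ y in 𝓝[Ioi x] x, distFun g y < ω :=
      (hrc.eventually_lt_const hlt).filter_mono (nhdsWithin_mono _ Ioi_subset_Ici_self)
    obtain ⟨y, hy, hyx⟩ := (hev.and (eventually_mem_nhdsWithin)).exists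
    have : y ≤ incrRearrangement g ω := le_csSup hbdd hy
    exact absurd (lt_of_lt_of_le (hyx : x < y) this) (not_lt.mpr h)
  · intro h
    refine csSup_le hne fun y hy => ?_
    rw [mem_setOf_eq] at hy
    by_contra hxy
    push Not at hxy
    have := distFun_mono hg hxy.le
    linarith

/-- `g*` is nondecreasing on `(0,1)`. [folklore] -/
theorem monotoneOn_incrRearrangement (hg : AEMeasurable g unitIoo) :
    MonotoneOn (incrRearrangement g) (Ioo (0 : ℝ) 1) := by
  intro a ha b hb hab
  exact csSup_le_csSup (bddAbove_ltSet hg hb.2) (nonempty_ltSet hg ha.1)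
    fun y (hy : distFun g y < a) => show distFun g y < b from lt_of_lt_of_le hy hab

/-- `g*` is a.e.-measurable on `(0,1)` (it is monotone there). [folklore] -/
theorem aemeasurable_incrRearrangement (hg : AEMeasurable g unitIoo) :
    AEMeasurable (incrRearrangement g) unitIoo :=
  aemeasurable_restrict_of_monotoneOn measurableSet_Ioo (monotoneOn_incrRearrangement hg)

/-- `λ{ω ∈ (0,1) : g*(ω) ≤ x} = F(x)`. [cite: Durrett2019, Thm 1.2.2 (p. 10)] -/
theorem measureReal_incrRearrangement_le (hg : AEMeasurable g unitIoo) (x : ℝ) :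
    unitIoo.real {ω | incrRearrangement g ω ≤ x} = distFun g x := by
  set c := distFun g x with hc
  have hc0 : 0 ≤ c := distFun_nonneg x
  have hc1 : c ≤ 1 := distFun_le_one x
  have hset : Ioo (0 : ℝ) 1 ∩ {ω | incrRearrangement g ω ≤ x} = Ioo (0 : ℝ) 1 ∩ Iic c := by
    ext ω
    simp only [mem_inter_iff, mem_setOf_eq, mem_Iic]
    constructor
    · rintro ⟨hω, h⟩; exact ⟨hω, (incrRearrangement_le_iff hg hω x).mp h⟩
    · rintro ⟨hω, h⟩; exact ⟨hω, (incrRearrangement_le_iff hg hω x).mpr h⟩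
  rw [unitIoo_def, measureReal_restrict_apply' measurableSet_Ioo, inter_comm, hset]
  -- `vol((0,1) ∩ (−∞, c]) = c`
  apply le_antisymm
  · calc volume.real (Ioo (0 : ℝ) 1 ∩ Iic c) ≤ volume.real (Ioc 0 c) := by
          refine measureReal_mono (fun ω ⟨hω, h⟩ => ⟨hω.1, h⟩) (by simp)
      _ = c := by simp [hc0]
  · calc c = volume.real (Ioo 0 c) := by simp [hc0]
      _ ≤ volume.real (Ioo (0 : ℝ) 1 ∩ Iic c) :=
          measureReal_mono (fun ω hω => ⟨⟨hω.1, hω.2.trans_le hc1⟩, hω.2.le⟩) (by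
            exact (measure_mono inter_subset_left |>.trans_lt (by simp)).ne)

/-- **`g*` has the same distribution as `g`.** [cite: Durrett2019, Thm 1.2.2 (p. 10)] -/
theorem law_incrRearrangement (hg : AEMeasurable g unitIoo) :
    law (incrRearrangement g) = law g := by
  haveI := isProbabilityMeasure_law hg
  haveI := isProbabilityMeasure_law (aemeasurable_incrRearrangement hg)
  apply MeasureTheory.Measure.eq_of_cdf
  ext x
  rw [← distFun_eq_cdf (aemeasurable_incrRearrangement hg), ← distFun_eq_cdf hg]
  exact measureReal_incrRearrangement_le hg x

/-- Transfer of integrals: `∫ φ(g*) = ∫ φ(g)` on `(0,1)`. [folklore] -/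
theorem integral_comp_incrRearrangement (hg : AEMeasurable g unitIoo) {φ : ℝ → ℝ}
    (hφ : Continuous φ) :
    ∫ ω, φ (incrRearrangement g ω) ∂unitIoo = ∫ s, φ (g s) ∂unitIoo := by
  have h1 := integral_map (aemeasurable_incrRearrangement hg) hφ.aestronglyMeasurable
    (μ := unitIoo)
  have h2 := integral_map hg hφ.aestronglyMeasurable (μ := unitIoo)
  rw [← h1, ← h2, ← law, ← law, law_incrRearrangement hg]

/-- `g*` is integrable when `g` is. [folklore] -/
theorem integrable_incrRearrangement (hg : Integrable g unitIoo) :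
    Integrable (incrRearrangement g) unitIoo := by
  have hgm := hg.aemeasurable
  have h1 : Integrable id (law g) := by
    rw [law]; exact (integrable_map_measure aestronglyMeasurable_id hgm).mpr hg
  rw [← law_incrRearrangement hgm, law] at h1
  exact (integrable_map_measure aestronglyMeasurable_id (aemeasurable_incrRearrangement hgm)).mp h1

/-! ## The rearrangement identity `∫₀¹ 2t g*(t) dt = ∫₀¹∫₀¹ max(g(s), g(t)) ds dt` -/

/-- Integrability of `(s, t) ↦ max(f s, h t)` on the product. [folklore] -/
theorem integrable_max_prod {f h : ℝ → ℝ} (hf : Integrable f unitIoo) (hh : Integrable h unitIoo) :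
    Integrable (fun p : ℝ × ℝ => max (f p.1) (h p.2)) (unitIoo.prod unitIoo) := by
  have h1 : Integrable (fun p : ℝ × ℝ => f p.1) (unitIoo.prod unitIoo) := hf.comp_fst _
  have h2 : Integrable (fun p : ℝ × ℝ => h p.2) (unitIoo.prod unitIoo) := hh.comp_snd _
  refine Integrable.mono' (h1.norm.add h2.norm) (h1.aemeasurable.max h2.aemeasurable).aestronglyMeasurable ?_
  filter_upwards with p
  simp only [Real.norm_eq_abs, Pi.add_apply]
  rcases le_total (f p.1) (h p.2) with hle | hle
  · rw [max_eq_right hle]; linarith [abs_nonneg (f p.1)]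
  · rw [max_eq_left hle]; linarith [abs_nonneg (h p.2)]

/-- Step 1: replace the inner `g` by `g*` (transfer), swap (Fubini), and transfer again:
`∫∫ max(g s, g t) = ∫∫ max(g* u, g* v)`. [folklore] -/
theorem integral_integral_max_eq (hg : Integrable g unitIoo) :
    ∫ s, ∫ t, max (g s) (g t) ∂unitIoo ∂unitIoo =
      ∫ v, ∫ u, max (incrRearrangement g u) (incrRearrangement g v) ∂unitIoo ∂unitIoo := by
  set X := incrRearrangement g with hXdef
  have hgm := hg.aemeasurable
  have hX : Integrable X unitIoo := integrable_incrRearrangement hg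
  -- inner transfer
  have h1 : ∀ s, ∫ t, max (g s) (g t) ∂unitIoo = ∫ v, max (g s) (X v) ∂unitIoo := fun s =>
    (integral_comp_incrRearrangement hgm (φ := fun y => max (g s) y) (continuous_const.max continuous_id)).symm
  simp_rw [h1]
  -- swap
  have hint : Integrable (Function.uncurry fun s v => max (g s) (X v)) (unitIoo.prod unitIoo) :=
    integrable_max_prod hg hX
  rw [integral_integral_swap hint]
  -- second transfer (in `s`, for fixed `v`)
  refine integral_congr_ae (Filter.Eventually.of_forall fun v => ?_)
  have h2 := (integral_comp_incrRearrangement hgm (φ := fun y => max y (X v))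
    (continuous_id.max continuous_const)).symm
  exact h2

/-- For `v ∈ (0,1)`: `∫ max(g* u, g* v) du = v · g*(v) + ∫_{(v,1)} g*`. [folklore] -/
theorem integral_max_incrRearrangement (hg : Integrable g unitIoo) {v : ℝ} (hv : v ∈ Ioo (0 : ℝ) 1) :
    ∫ u, max (incrRearrangement g u) (incrRearrangement g v) ∂unitIoo =
      v * incrRearrangement g v + ∫ u in Ioo v 1, incrRearrangement g u := by
  set X := incrRearrangement g with hXdef
  have hmono := monotoneOn_incrRearrangement hg.aemeasurable
  have hX : Integrable X unitIoo := integrable_incrRearrangement hg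
  -- `max (X u) (X v) = X (max u v)` on `(0,1)`; split `(0,1) = (0,v] ∪ (v,1)`
  have hae : ∀ᵐ u ∂unitIoo, max (X u) (X v) =
      (Iic v).indicator (fun _ => X v) u + (Ioi v).indicator X u := by
    filter_upwards [ae_mem_unitIoo] with u hu
    by_cases huv : u ≤ v
    · rw [indicator_of_mem (show u ∈ Iic v from huv), indicator_of_notMem (show u ∉ Ioi v from
        not_lt.mpr huv), add_zero, max_eq_right (hmono hu hv huv)]
    · push Not at huv
      rw [indicator_of_notMem (show u ∉ Iic v from not_le.mpr huv),
        indicator_of_mem (show u ∈ Ioi v from huv), zero_add, max_eq_left (hmono hv hu huv.le)]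
  rw [integral_congr_ae hae]
  have hi1 : Integrable ((Iic v).indicator fun _ : ℝ => X v) unitIoo :=
    (integrable_const (X v)).indicator measurableSet_Iic
  have hi2 : Integrable ((Ioi v).indicator X) unitIoo := hX.indicator measurableSet_Ioi
  rw [integral_add hi1 hi2, integral_indicator measurableSet_Iic, integral_indicator measurableSet_Ioi]
  congr 1
  · -- `∫_{(0,1) ∩ (−∞,v]} X v = v · X v`
    rw [setIntegral_const, unitIoo_def, measureReal_restrict_apply measurableSet_Iic]
    have : Iic v ∩ Ioo (0 : ℝ) 1 = Ioc 0 v := by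
      ext u; simp only [mem_inter_iff, mem_Iic, mem_Ioo, mem_Ioc]
      constructor
      · rintro ⟨h1, h2, _⟩; exact ⟨h2, h1⟩
      · rintro ⟨h1, h2⟩; exact ⟨h2, h1, h2.trans_lt hv.2⟩
    rw [this, Real.volume_real_Ioc_of_le hv.1.le, sub_zero, smul_eq_mul]
  · rw [unitIoo_def, Measure.restrict_restrict measurableSet_Ioi]
    congr 1
    congr 1
    ext u; simp only [mem_inter_iff, mem_Ioi, mem_Ioo]
    constructor
    · rintro ⟨h1, _, h3⟩; exact ⟨h1, h3⟩
    · rintro ⟨h1, h2⟩; exact ⟨h1, hv.1.trans h1, h2⟩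

/-- `∫_{(0,1)} ∫_{(v,1)} g*(u) du dv = ∫_{(0,1)} u g*(u) du` (Fubini on the triangle). [folklore] -/
theorem integral_integral_Ioi_incrRearrangement (hg : Integrable g unitIoo) :
    ∫ v, (∫ u in Ioo v 1, incrRearrangement g u) ∂unitIoo =
      ∫ u, u * incrRearrangement g u ∂unitIoo := by
  set X := incrRearrangement g with hXdef
  have hX : Integrable X unitIoo := integrable_incrRearrangement hg
  -- write the inner integral as `∫ u, 1[v < u] X u ∂unitIoo`
  have h1 : ∀ v ∈ Ioo (0 : ℝ) 1, ∫ u in Ioo v 1, X u = ∫ u, (Ioi v).indicator X u ∂unitIoo := by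
    intro v hv
    rw [integral_indicator measurableSet_Ioi, unitIoo_def,
      Measure.restrict_restrict measurableSet_Ioi]
    congr 1; congr 1
    ext u; simp only [mem_inter_iff, mem_Ioi, mem_Ioo]
    constructor
    · rintro ⟨h1, h2⟩; exact ⟨h1, hv.1.trans h1, h2⟩
    · rintro ⟨h1, _, h3⟩; exact ⟨h1, h3⟩
  have h1' : ∀ᵐ v ∂unitIoo, ∫ u in Ioo v 1, X u = ∫ u, (Ioi v).indicator X u ∂unitIoo := by
    filter_upwards [ae_mem_unitIoo] with v hv using h1 v hv
  rw [integral_congr_ae h1']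
  -- Fubini: the integrand `(v,u) ↦ 1[v<u] X u` is the indicator of `{v < u}` applied to `X ∘ snd`
  have hF : (Function.uncurry fun v u : ℝ => (Ioi v).indicator X u) =
      {p : ℝ × ℝ | p.1 < p.2}.indicator fun p => X p.2 := by
    ext p
    rcases p with ⟨v, u⟩
    simp only [Function.uncurry_apply_pair, indicator, mem_Ioi, mem_setOf_eq]
  have hint : Integrable (Function.uncurry fun v u : ℝ => (Ioi v).indicator X u)
      (unitIoo.prod unitIoo) := by
    rw [hF]
    exact (hX.comp_snd _).indicator (measurableSet_lt measurable_fst measurable_snd)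
  rw [integral_integral_swap hint]
  refine integral_congr_ae ?_
  filter_upwards [ae_mem_unitIoo] with u hu
  -- `∫ v, 1[v < u] X u ∂unitIoo = vol((0,1) ∩ (−∞,u)) X u = u X u`
  have h2 : (fun v => (Ioi v).indicator X u) = (Iio u).indicator fun _ => X u := by
    ext v
    simp only [indicator, mem_Ioi, mem_Iio]
  rw [h2, integral_indicator measurableSet_Iio, setIntegral_const, unitIoo_def,
    measureReal_restrict_apply measurableSet_Iio]
  have : Iio u ∩ Ioo (0 : ℝ) 1 = Ioo 0 u := by
    ext v; simp only [mem_inter_iff, mem_Iio, mem_Ioo]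
    constructor
    · rintro ⟨h1, h2, _⟩; exact ⟨h2, h1⟩
    · rintro ⟨h1, h2⟩; exact ⟨h2, h1, h2.trans hu.2⟩
  rw [this, Real.volume_real_Ioo_of_le hu.1.le, sub_zero, smul_eq_mul]

/-- **The rearrangement identity** `∫₀¹ 2t · g*(t) dt = ∫₀¹ ∫₀¹ max(g(s), g(t)) ds dt` for
integrable `g : (0,1) → ℝ` and its increasing rearrangement `g*`.
[cite: CalegariDimitrovTang2024, §2.4 eq. (maxintegral) (p. 11)] -/
theorem integral_two_mul_incrRearrangement (hg : Integrable g unitIoo) :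
    ∫ t, 2 * t * incrRearrangement g t ∂unitIoo =
      ∫ s, ∫ t, max (g s) (g t) ∂unitIoo ∂unitIoo := by
  have hX : Integrable (incrRearrangement g) unitIoo := integrable_incrRearrangement hg
  have htX : Integrable (fun t => t * incrRearrangement g t) unitIoo := by
    refine hX.bdd_mul (c := 1) aestronglyMeasurable_id ?_
    rw [unitIoo_def, ae_restrict_iff' measurableSet_Ioo]
    filter_upwards with t ht
    rw [Real.norm_eq_abs, abs_le]; exact ⟨by linarith [ht.1], ht.2.le⟩
  rw [integral_integral_max_eq hg]
  change ∫ t, 2 * t * incrRearrangement g t ∂unitIoo =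
    ∫ v, ∫ u, max (incrRearrangement g u) (incrRearrangement g v) ∂unitIoo ∂unitIoo
  have h1 : ∀ᵐ v ∂unitIoo, ∫ u, max (incrRearrangement g u) (incrRearrangement g v) ∂unitIoo =
      v * incrRearrangement g v + ∫ u in Ioo v 1, incrRearrangement g u := by
    filter_upwards [ae_mem_unitIoo] with v hv using integral_max_incrRearrangement hg hv
  rw [integral_congr_ae h1]
  have hI : Integrable (fun v => ∫ u in Ioo v 1, incrRearrangement g u) unitIoo := by
    -- it is a.e. equal to `∫ u, 1[v<u] incrRearrangement g u`, an integral of a product-integrable function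
    have hF : (Function.uncurry fun v u : ℝ => (Ioi v).indicator (incrRearrangement g) u) =
        {p : ℝ × ℝ | p.1 < p.2}.indicator fun p => incrRearrangement g p.2 := by
      ext p
      rcases p with ⟨v, u⟩
      simp only [Function.uncurry_apply_pair, indicator, mem_Ioi, mem_setOf_eq]
    have hint : Integrable (Function.uncurry fun v u : ℝ => (Ioi v).indicator (incrRearrangement g) u)
        (unitIoo.prod unitIoo) := by
      rw [hF]
      exact (hX.comp_snd _).indicator (measurableSet_lt measurable_fst measurable_snd)
    have h3 := hint.integral_prod_left
    refine h3.congr ?_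
    filter_upwards [ae_mem_unitIoo] with v hv
    simp only [Function.uncurry_apply_pair]
    rw [unitIoo_def]
    rw [integral_indicator measurableSet_Ioi, Measure.restrict_restrict measurableSet_Ioi]
    congr 1; congr 1
    ext u; simp only [mem_inter_iff, mem_Ioi, mem_Ioo]
    constructor
    · rintro ⟨h1, _, h3⟩; exact ⟨h1, h3⟩
    · rintro ⟨h1, h2⟩; exact ⟨h1, hv.1.trans h1, h2⟩
  rw [integral_add htX hI, integral_integral_Ioi_incrRearrangement hg, ← two_mul, ← integral_const_mul]
  refine integral_congr_ae (Filter.Eventually.of_forall fun t => ?_)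
  ring


/-- **The trivial bound** `∫₀¹ 2t g*(t) dt ≤ 2 ∫₀¹ max(g(t), 0) dt` (since `2t g*(t) ≤ 2 max(g*(t),0)`
on `(0,1)` and `g*`, `g` are equimeasurable), recovering the `e ⇝ 2` coefficient.
[cite: CalegariDimitrovTang2024, §2.4, display after eq. (maxintegral) (p. 11)] -/
theorem integral_two_mul_incrRearrangement_le (hg : Integrable g unitIoo) :
    ∫ t, 2 * t * incrRearrangement g t ∂unitIoo ≤ 2 * ∫ t, max (g t) 0 ∂unitIoo := by
  have hX : Integrable (incrRearrangement g) unitIoo := integrable_incrRearrangement hg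
  have htX : Integrable (fun t => 2 * t * incrRearrangement g t) unitIoo := by
    have : Integrable (fun t => t * incrRearrangement g t) unitIoo := by
      refine hX.bdd_mul (c := 1) aestronglyMeasurable_id ?_
      filter_upwards [ae_mem_unitIoo] with t ht
      rw [Real.norm_eq_abs, abs_le]; exact ⟨by linarith [ht.1], ht.2.le⟩
    have h2 := this.const_mul 2
    refine h2.congr (Filter.Eventually.of_forall fun t => ?_)
    simp only; ring
  have hmax : Integrable (fun t => max (incrRearrangement g t) 0) unitIoo := hX.pos_part
  have htr : ∫ t, max (incrRearrangement g t) 0 ∂unitIoo = ∫ t, max (g t) 0 ∂unitIoo :=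
    integral_comp_incrRearrangement hg.aemeasurable (φ := fun y => max y 0)
      (continuous_id.max continuous_const)
  rw [← htr, ← integral_const_mul]
  refine integral_mono_ae htX (hmax.const_mul 2) ?_
  filter_upwards [ae_mem_unitIoo] with t ht
  rcases le_total 0 (incrRearrangement g t) with h | h
  · rw [max_eq_left h]; nlinarith [ht.2]
  · rw [max_eq_right h]; nlinarith [ht.1]


end Literature.MeasureTheory.Integral
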